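import Summits.Ventures.PackingBounds.Configurations.ListConfigKeys
import Summits.Ventures.PackingBounds.Configurations.SectionTransfer
import Mathlib.NumberTheory.Zsqrtd.ToReal

/-!
# `A(24, arccos 1/6) ≥ 281`: the McLaughlin configuration `(22, 275, 1/6)` plus a hexagonal polar cluster over an exact flat direction

Framing: lottery ticket; floor = certified bounds/negative ranges. Venture `PackingBounds` (cell `pub-packcert`, seat `pub-packcert-sdp`,
B2c ATTAINED side, cell `(24, 1/6)`; previous kernel value `279` = two dimension lifts of `Config.Dim22Card275`,
`SphericalCodes.exists_code_dim24_sixth_279` (`DimensionLift`); certified upper value `340`). Kind (b): an explicit object written down here;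
no optimality claim; UNCOUNTED.

OBJECT (exact — "polar clusters over a flat direction", device 8 of sdp gen 19; sdp gen 18 had identified this `281` as a "zero-slack boundary
case, probably not rationalisable" — it is rational in `ℤ[√105]` as below). `M ⊂ S²¹`: the `275` McLaughlin vectors `v/√480` of `Config.Dim22Card275`
(integer rows of `ℤ²⁴` orthogonal to the two integer normals `(5, 1²³)`, `(3, 7, −1²²)`; cosines `1/6`, `−1/4`).  The integer vector
`w = (1,−1,2,−1,−1,−1,−1,2,2,−1,2,−1,−4,−1,−1,−1,−1,2,2,−1,−1,−1,2,−1)` (`|w|² = 60`, orthogonal to both normals; found by an LP flatness search,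
kit j230482) has `w·v ∈ {0, ±60}` on `M` (`175 / 50 / 50` times), i.e. `u = w/√60` is flat with `max |u·k| = 60/√(60·480) = 1/(2√2)`.  In
`ℝ²² ⊕ ℝ²` take `M × {0}` and the six points `p_j = ((−1)^j (√2/3) u, (√7/3) h_j)`, `h_j` a regular hexagon: `p_j·k = ±(√2/3)(u·k) ∈ {0, ±1/6}`,
`p_j·p_{j+1} = −2/9 + 7/18 = 1/6`, `p_j·p_{j+2} = 2/9 − 7/18 = −1/6`, `p_j·p_{j+3} = −1`; all cosines `≤ 1/6` (every constraint tight: `a² = 2/9` is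
forced by `a·(1/(2√2)) ≤ 1/6` and `−a² + (1−a²)/2 ≤ 1/6`).  Hence `A(24, arccos 1/6) ≥ 275 + 6 = 281`.  (`ℝ²³`: one point per pole only, the lift `277`.)

Kernel content: ambient `ℤ[√105]²⁷` (`Zsqrtd 105`): rows `(3v, 0, 0, 0)` and `(±4w, 4√105·a_j)` with `a_j` the hexagon `±(1,−1,0), ±(1,0,−1), ±(0,1,−1)`
of the plane `x + y + z = 0` (so the cluster plane needs no `√3`), squared length `4320`, pairwise products in `{720, 0, −720, −1080, −4320}` (rational
integers `≤ 4320/6`); three pairwise-orthogonal normals (the two McLaughlin normals padded, and `(0²⁴, 1, 1, 1)`), so the configuration spans a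
subspace of dimension `≤ 24` and `Config.exists_transfer_orthogonal` (`SectionTransfer`, with `linearIndependent_normals` / `inner_normals_eq_zero`)
moves it to `ℝ²⁴`.  `ListConfigKeys` over `Zsqrtd 105` (`Zsqrtd.toReal`): `shapeOK`, `keysRowsOK` (six chunks), `normalsOK`, `orthOK` by
`decide +kernel`, keys bounded by `norm_num`.  Exact check also in `code/gen_mcl_polar.py` (pure Python, arithmetic in `ℤ[√105]`).  Result:
**`exists_code_dim24_sixth_281 : A(24, arccos 1/6) ≥ 281`**.
-/

namespace Summit.Ventures.PackingBounds.Config.CodeSixth24McLHexagon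

open Finset Summit.Ventures.PackingBounds.Config

/-- `0 ≤ 105`. -/
private theorem hD : (0 : ℤ) ≤ 105 := by norm_num

/-- `105` is not a square. -/
private theorem d_not_square : ∀ k : ℤ, (105 : ℤ) ≠ k * k := by
  intro k h
  have h1 : k.natAbs * k.natAbs = 105 := by
    have := Int.natAbs_mul_self' k; omega
  have h2 : k.natAbs ≤ 11 := by nlinarith
  interval_cases h : k.natAbs <;> omega

/-- `0`. -/
def o : Zsqrtd 105 := ⟨0, 0⟩
/-- `1`. -/
def p : Zsqrtd 105 := ⟨1, 0⟩
/-- `-1`. -/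
def m : Zsqrtd 105 := ⟨-1, 0⟩
/-- `3`. -/
def a : Zsqrtd 105 := ⟨3, 0⟩
/-- `-3`. -/
def b : Zsqrtd 105 := ⟨-3, 0⟩
/-- `4`. -/
def c : Zsqrtd 105 := ⟨4, 0⟩
/-- `-4`. -/
def d : Zsqrtd 105 := ⟨-4, 0⟩
/-- `5`. -/
def e : Zsqrtd 105 := ⟨5, 0⟩
/-- `-6`. -/
def f : Zsqrtd 105 := ⟨-6, 0⟩
/-- `7`. -/
def g : Zsqrtd 105 := ⟨7, 0⟩
/-- `8`. -/
def h : Zsqrtd 105 := ⟨8, 0⟩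
/-- `-8`. -/
def i : Zsqrtd 105 := ⟨-8, 0⟩
/-- `9`. -/
def j : Zsqrtd 105 := ⟨9, 0⟩
/-- `12`. -/
def k : Zsqrtd 105 := ⟨12, 0⟩
/-- `-12`. -/
def l : Zsqrtd 105 := ⟨-12, 0⟩
/-- `16`. -/
def r : Zsqrtd 105 := ⟨16, 0⟩
/-- `-16`. -/
def s : Zsqrtd 105 := ⟨-16, 0⟩
/-- `18`. -/
def t : Zsqrtd 105 := ⟨18, 0⟩
/-- `-18`. -/
def u : Zsqrtd 105 := ⟨-18, 0⟩
/-- `-21`. -/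
def v : Zsqrtd 105 := ⟨-21, 0⟩
/-- `24`. -/
def w : Zsqrtd 105 := ⟨24, 0⟩
/-- `54`. -/
def x : Zsqrtd 105 := ⟨54, 0⟩
/-- `4√105`. -/
def y : Zsqrtd 105 := ⟨0, 4⟩
/-- `-4√105`. -/
def z : Zsqrtd 105 := ⟨0, -4⟩

set_option maxHeartbeats 4000000 in
/-- Rows `0` – `46`. -/
def rowsA : List (List (Zsqrtd 105)) := [
  [t, u, x, f, f, f, f, f, f, f, f, f, f, f, f, f, f, f, f, f, f, f, f, f, o, o, o], [t, u, f, x, f, f, f, f, f, f, f, f, f, f, f, f, f, f, f, f, f, f, f, f, o, o, o],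
  [t, u, f, f, x, f, f, f, f, f, f, f, f, f, f, f, f, f, f, f, f, f, f, f, o, o, o], [t, u, f, f, f, x, f, f, f, f, f, f, f, f, f, f, f, f, f, f, f, f, f, f, o, o, o],
  [t, u, f, f, f, f, x, f, f, f, f, f, f, f, f, f, f, f, f, f, f, f, f, f, o, o, o], [t, u, f, f, f, f, f, x, f, f, f, f, f, f, f, f, f, f, f, f, f, f, f, f, o, o, o],
  [t, u, f, f, f, f, f, f, x, f, f, f, f, f, f, f, f, f, f, f, f, f, f, f, o, o, o], [t, u, f, f, f, f, f, f, f, x, f, f, f, f, f, f, f, f, f, f, f, f, f, f, o, o, o],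
  [t, u, f, f, f, f, f, f, f, f, x, f, f, f, f, f, f, f, f, f, f, f, f, f, o, o, o], [t, u, f, f, f, f, f, f, f, f, f, x, f, f, f, f, f, f, f, f, f, f, f, f, o, o, o],
  [t, u, f, f, f, f, f, f, f, f, f, f, x, f, f, f, f, f, f, f, f, f, f, f, o, o, o], [t, u, f, f, f, f, f, f, f, f, f, f, f, x, f, f, f, f, f, f, f, f, f, f, o, o, o],
  [t, u, f, f, f, f, f, f, f, f, f, f, f, f, x, f, f, f, f, f, f, f, f, f, o, o, o], [t, u, f, f, f, f, f, f, f, f, f, f, f, f, f, x, f, f, f, f, f, f, f, f, o, o, o],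
  [t, u, f, f, f, f, f, f, f, f, f, f, f, f, f, f, x, f, f, f, f, f, f, f, o, o, o], [t, u, f, f, f, f, f, f, f, f, f, f, f, f, f, f, f, x, f, f, f, f, f, f, o, o, o],
  [t, u, f, f, f, f, f, f, f, f, f, f, f, f, f, f, f, f, x, f, f, f, f, f, o, o, o], [t, u, f, f, f, f, f, f, f, f, f, f, f, f, f, f, f, f, f, x, f, f, f, f, o, o, o],
  [t, u, f, f, f, f, f, f, f, f, f, f, f, f, f, f, f, f, f, f, x, f, f, f, o, o, o], [t, u, f, f, f, f, f, f, f, f, f, f, f, f, f, f, f, f, f, f, f, x, f, f, o, o, o],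
  [t, u, f, f, f, f, f, f, f, f, f, f, f, f, f, f, f, f, f, f, f, f, x, f, o, o, o], [t, u, f, f, f, f, f, f, f, f, f, f, f, f, f, f, f, f, f, f, f, f, f, x, o, o, o],
  [l, k, f, f, f, f, f, f, f, f, f, f, f, w, f, w, f, w, w, w, f, f, f, w, o, o, o], [l, k, f, f, f, f, f, f, f, f, f, w, f, f, f, f, w, f, w, w, f, w, w, f, o, o, o],
  [l, k, f, f, f, f, f, f, f, w, f, w, f, f, w, f, f, w, w, f, w, f, f, f, o, o, o], [l, k, f, f, f, f, f, f, f, w, w, f, w, w, f, f, f, f, w, f, f, f, w, f, o, o, o],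
  [l, k, f, f, f, f, f, f, w, f, f, f, f, f, f, f, w, w, f, f, w, w, f, w, o, o, o], [l, k, f, f, f, f, f, f, w, f, f, w, f, w, f, w, f, f, f, f, w, f, w, f, o, o, o],
  [l, k, f, f, f, f, f, f, w, f, w, f, w, f, w, w, f, w, f, f, f, f, f, f, o, o, o], [l, k, f, f, f, f, f, f, w, w, f, f, f, f, w, f, f, f, f, w, f, f, w, w, o, o, o],
  [l, k, f, f, f, f, f, w, f, f, f, f, w, w, w, f, f, f, f, f, w, f, f, w, o, o, o], [l, k, f, f, f, f, f, w, f, f, w, f, f, w, f, w, w, f, f, f, f, w, f, f, o, o, o],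
  [l, k, f, f, f, f, f, w, f, f, w, w, f, f, f, f, f, w, f, f, f, f, w, w, o, o, o], [l, k, f, f, f, f, f, w, f, w, f, w, w, f, f, w, f, f, f, w, f, f, f, f, o, o, o],
  [l, k, f, f, f, f, f, w, w, f, w, f, f, f, f, f, f, f, w, w, w, f, f, f, o, o, o], [l, k, f, f, f, f, w, f, f, f, f, f, f, w, w, f, f, w, f, f, f, w, w, f, o, o, o],
  [l, k, f, f, f, f, w, f, f, f, f, w, f, f, w, w, w, f, f, f, f, f, f, w, o, o, o], [l, k, f, f, f, f, w, f, f, f, w, w, w, f, f, f, f, f, f, f, w, w, f, f, o, o, o],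
  [l, k, f, f, f, f, w, f, f, w, f, f, f, w, f, f, w, f, f, w, w, f, f, f, o, o, o], [l, k, f, f, f, f, w, f, w, w, f, f, f, f, f, w, f, f, w, f, f, w, f, f, o, o, o],
  [l, k, f, f, f, f, w, w, w, f, f, f, w, f, f, f, w, f, f, f, f, f, w, f, o, o, o], [l, k, f, f, f, w, f, f, f, f, f, f, f, f, w, w, f, f, f, w, w, w, f, f, o, o, o],
  [l, k, f, f, f, w, f, f, f, f, w, f, w, f, f, f, w, f, f, w, f, f, f, w, o, o, o], [l, k, f, f, f, w, f, f, f, w, f, f, f, f, f, w, w, w, f, f, f, f, w, f, o, o, o],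
  [l, k, f, f, f, w, f, f, f, w, f, w, f, w, f, f, f, f, f, f, f, w, f, w, o, o, o], [l, k, f, f, f, w, f, f, w, f, f, f, f, w, w, f, w, f, w, f, f, f, f, f, o, o, o],
  [l, k, f, f, f, w, f, w, f, f, f, f, w, f, f, f, f, w, w, f, f, w, f, f, o, o, o]]

set_option maxHeartbeats 4000000 in
/-- Rows `47` – `93`. -/
def rowsB : List (List (Zsqrtd 105)) := [
  [l, k, f, f, f, w, w, f, f, f, f, f, f, f, f, f, f, f, w, f, w, f, w, w, o, o, o], [l, k, f, f, f, w, w, f, w, f, f, w, f, f, f, f, f, w, f, w, f, f, f, f, o, o, o],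
  [l, k, f, f, f, w, w, w, f, w, w, f, f, f, w, f, f, f, f, f, f, f, f, f, o, o, o], [l, k, f, f, w, f, f, f, f, f, f, f, w, f, f, w, w, f, w, f, w, f, f, f, o, o, o],
  [l, k, f, f, w, f, f, f, f, f, w, f, f, f, w, f, f, f, w, f, f, w, f, w, o, o, o], [l, k, f, f, w, f, f, f, w, f, f, f, w, w, f, f, f, f, f, w, f, w, f, f, o, o, o],
  [l, k, f, f, w, f, f, f, w, w, w, w, f, f, f, f, w, f, f, f, f, f, f, f, o, o, o], [l, k, f, f, w, f, f, w, f, f, f, f, f, f, w, f, w, w, f, w, f, f, f, f, o, o, o],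
  [l, k, f, f, w, f, f, w, f, w, f, f, f, f, f, f, f, f, f, f, w, w, w, f, o, o, o], [l, k, f, f, w, f, w, f, f, f, w, f, f, f, f, w, f, f, f, w, f, f, w, f, o, o, o],
  [l, k, f, f, w, f, w, f, f, w, f, f, w, f, f, f, f, w, f, f, f, f, f, w, o, o, o], [l, k, f, f, w, f, w, w, f, f, f, w, f, w, f, f, f, f, w, f, f, f, f, f, o, o, o],
  [l, k, f, f, w, w, f, f, f, f, f, w, w, f, w, f, f, f, f, f, f, f, w, f, o, o, o], [l, k, f, f, w, w, f, f, f, f, w, f, f, w, f, f, f, w, f, f, w, f, f, f, o, o, o],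
  [l, k, f, f, w, w, f, w, w, f, f, f, f, f, f, w, f, f, f, f, f, f, f, w, o, o, o], [l, k, f, w, f, f, f, f, f, f, f, f, w, f, f, w, f, f, f, f, f, w, w, w, o, o, o],
  [l, k, f, w, f, f, f, f, f, f, f, w, w, w, f, f, w, w, f, f, f, f, f, f, o, o, o], [l, k, f, w, f, f, f, f, f, f, w, f, f, f, w, f, w, f, f, f, w, f, w, f, o, o, o],
  [l, k, f, w, f, f, f, f, f, w, w, f, f, f, f, f, f, w, f, w, f, w, f, f, o, o, o], [l, k, f, w, f, f, f, w, f, w, f, f, f, f, f, f, w, f, w, f, f, f, f, w, o, o, o],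
  [l, k, f, w, f, f, f, w, w, f, f, w, f, f, w, f, f, f, f, f, f, w, f, f, o, o, o], [l, k, f, w, f, f, w, f, f, f, f, f, w, f, w, f, f, f, w, w, f, f, f, f, o, o, o],
  [l, k, f, w, f, f, w, f, w, f, w, f, f, w, f, f, f, f, f, f, f, f, f, w, o, o, o], [l, k, f, w, f, f, w, w, f, f, f, f, f, f, f, w, f, w, f, f, w, f, f, f, o, o, o],
  [l, k, f, w, f, w, f, f, f, f, w, w, f, f, f, w, f, f, w, f, f, f, f, f, o, o, o], [l, k, f, w, f, w, f, f, w, w, f, f, w, f, f, f, f, f, f, f, w, f, f, f, o, o, o],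
  [l, k, f, w, f, w, f, w, f, f, f, f, f, w, f, f, f, f, f, w, f, f, w, f, o, o, o], [l, k, f, w, w, f, f, f, f, f, f, w, f, f, f, f, f, f, f, w, w, f, f, w, o, o, o],
  [l, k, f, w, w, f, f, f, f, w, f, f, f, w, w, w, f, f, f, f, f, f, f, f, o, o, o], [l, k, f, w, w, f, f, f, w, f, f, f, f, f, f, f, f, w, w, f, f, f, w, f, o, o, o],
  [l, k, f, w, w, w, w, f, f, f, f, f, f, f, f, f, w, f, f, f, f, w, f, f, o, o, o], [l, k, w, f, f, f, f, f, f, f, f, f, w, f, f, f, f, w, f, w, w, f, w, f, o, o, o],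
  [l, k, w, f, f, f, f, f, f, f, w, w, f, w, w, f, f, f, f, w, f, f, f, f, o, o, o], [l, k, w, f, f, f, f, f, f, w, f, f, w, f, w, f, w, f, f, f, f, w, f, f, o, o, o],
  [l, k, w, f, f, f, f, f, f, w, w, f, f, f, f, w, f, f, f, f, w, f, f, w, o, o, o], [l, k, w, f, f, f, f, f, w, f, f, w, w, f, f, f, f, f, w, f, f, f, f, w, o, o, o],
  [l, k, w, f, f, f, f, w, f, f, f, f, f, f, w, w, f, f, w, f, f, f, w, f, o, o, o], [l, k, w, f, f, f, f, w, w, w, f, f, f, w, f, f, f, w, f, f, f, f, f, f, o, o, o],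
  [l, k, w, f, f, f, w, f, f, f, w, f, f, f, f, f, w, w, w, f, f, f, f, f, o, o, o], [l, k, w, f, f, f, w, w, f, f, f, f, f, f, f, f, f, f, f, w, f, w, f, w, o, o, o],
  [l, k, w, f, f, w, f, f, w, f, w, f, f, f, f, f, f, f, f, f, f, w, w, f, o, o, o], [l, k, w, f, f, w, f, w, f, f, f, w, f, f, f, f, w, f, f, f, w, f, f, f, o, o, o],
  [l, k, w, f, f, w, w, f, f, f, f, f, w, w, f, w, f, f, f, f, f, f, f, f, o, o, o], [l, k, w, f, w, f, f, f, f, f, f, f, f, w, f, f, w, f, f, f, f, f, w, w, o, o, o],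
  [l, k, w, f, w, f, f, f, f, f, f, w, f, f, f, w, f, w, f, f, f, w, f, f, o, o, o], [l, k, w, f, w, f, w, f, w, f, f, f, f, f, w, f, f, f, f, f, w, f, f, f, o, o, o],
  [l, k, w, f, w, w, f, f, f, w, f, f, f, f, f, f, f, f, w, w, f, f, f, f, o, o, o]]

set_option maxHeartbeats 4000000 in
/-- Rows `94` – `140`. -/
def rowsC : List (List (Zsqrtd 105)) := [
  [l, k, w, w, f, f, f, f, f, f, f, f, f, w, f, f, f, f, w, f, w, w, f, f, o, o, o], [l, k, w, w, f, f, f, f, w, f, f, f, f, f, f, w, w, f, f, w, f, f, f, f, o, o, o],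
  [l, k, w, w, f, f, w, f, f, w, f, w, f, f, f, f, f, f, f, f, f, f, w, f, o, o, o], [l, k, w, w, f, w, f, f, f, f, f, f, f, f, w, f, f, w, f, f, f, f, f, w, o, o, o],
  [l, k, w, w, w, f, f, w, f, f, w, f, w, f, f, f, f, f, f, f, f, f, f, f, o, o, o], [a, b, j, j, j, j, j, j, j, j, j, j, v, j, v, j, v, v, v, j, j, j, v, v, o, o, o],
  [a, b, j, j, j, j, j, j, j, j, j, v, v, v, v, v, j, j, v, j, j, v, j, j, o, o, o], [a, b, j, j, j, j, j, j, j, j, v, j, j, j, j, v, j, v, v, j, v, v, v, j, o, o, o],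
  [a, b, j, j, j, j, j, j, j, j, v, v, j, v, j, j, v, j, v, j, v, j, j, v, o, o, o], [a, b, j, j, j, j, j, j, j, v, j, j, v, j, j, j, j, j, v, v, v, v, j, v, o, o, o],
  [a, b, j, j, j, j, j, j, j, v, v, j, j, j, v, v, v, j, v, v, j, j, j, j, o, o, o], [a, b, j, j, j, j, j, j, v, j, j, v, v, j, v, j, v, j, j, v, v, j, j, j, o, o, o],
  [a, b, j, j, j, j, j, j, v, j, v, j, j, v, j, j, v, v, j, v, j, j, v, j, o, o, o], [a, b, j, j, j, j, j, j, v, j, v, v, j, j, j, v, j, j, j, v, j, v, j, v, o, o, o],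
  [a, b, j, j, j, j, j, j, v, v, j, j, v, v, j, v, v, j, j, j, j, j, j, v, o, o, o], [a, b, j, j, j, j, j, j, v, v, j, v, v, j, j, j, j, v, j, j, j, v, v, j, o, o, o],
  [a, b, j, j, j, j, j, j, v, v, v, j, j, v, v, j, j, j, j, j, v, v, j, j, o, o, o], [a, b, j, j, j, j, j, v, j, j, j, j, j, j, j, v, v, j, j, v, v, j, v, v, o, o, o],
  [a, b, j, j, j, j, j, v, j, j, j, v, j, v, j, j, j, v, j, v, v, v, j, j, o, o, o], [a, b, j, j, j, j, j, v, j, j, v, j, v, j, v, j, j, j, j, v, j, v, v, j, o, o, o],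
  [a, b, j, j, j, j, j, v, j, v, j, j, j, j, v, v, j, v, j, j, j, v, j, v, o, o, o], [a, b, j, j, j, j, j, v, j, v, j, v, j, v, v, j, v, j, j, j, j, j, v, j, o, o, o],
  [a, b, j, j, j, j, j, v, j, v, v, j, v, j, j, j, v, v, j, j, v, j, j, j, o, o, o], [a, b, j, j, j, j, j, v, v, j, j, j, j, v, j, j, j, j, v, j, j, v, v, v, o, o, o],
  [a, b, j, j, j, j, j, v, v, j, j, v, j, j, j, v, v, v, v, j, j, j, j, j, o, o, o], [a, b, j, j, j, j, v, j, j, j, j, j, v, j, j, v, v, v, j, v, j, v, j, j, o, o, o],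
  [a, b, j, j, j, j, v, j, j, j, j, v, v, v, j, j, j, j, j, v, j, j, v, v, o, o, o], [a, b, j, j, j, j, v, j, j, j, v, j, j, j, v, j, j, v, j, v, v, j, j, v, o, o, o],
  [a, b, j, j, j, j, v, j, j, v, j, j, v, j, v, v, j, j, j, j, v, j, v, j, o, o, o], [a, b, j, j, j, j, v, j, j, v, v, j, j, j, j, j, v, j, j, j, j, v, v, v, o, o, o],
  [a, b, j, j, j, j, v, j, j, v, v, v, j, v, j, v, j, v, j, j, j, j, j, j, o, o, o], [a, b, j, j, j, j, v, j, v, j, j, j, v, v, j, j, j, v, v, j, v, j, j, j, o, o, o],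
  [a, b, j, j, j, j, v, j, v, j, v, v, j, j, v, j, j, j, v, j, j, j, v, j, o, o, o], [a, b, j, j, j, j, v, v, j, j, j, j, j, j, v, j, v, j, v, j, v, v, j, j, o, o, o],
  [a, b, j, j, j, j, v, v, j, j, v, j, v, j, j, v, j, j, v, j, j, j, j, v, o, o, o], [a, b, j, j, j, j, v, v, j, v, j, j, j, j, j, j, j, v, v, v, j, j, v, j, o, o, o],
  [a, b, j, j, j, j, v, v, v, j, j, j, j, v, v, v, j, j, j, v, j, j, j, j, o, o, o], [a, b, j, j, j, j, v, v, v, v, j, v, j, j, j, j, j, j, j, j, v, j, j, v, o, o, o],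
  [a, b, j, j, j, v, j, j, j, j, j, j, v, v, j, j, v, j, j, j, v, v, v, j, o, o, o], [a, b, j, j, j, v, j, j, j, j, j, v, v, j, j, v, j, v, j, j, v, j, j, v, o, o, o],
  [a, b, j, j, j, v, j, j, j, j, v, j, j, v, v, v, j, j, j, j, j, j, v, v, o, o, o], [a, b, j, j, j, v, j, j, j, j, v, v, j, j, v, j, v, v, j, j, j, v, j, j, o, o, o],
  [a, b, j, j, j, v, j, j, j, v, j, j, v, v, v, j, j, v, j, v, j, j, j, j, o, o, o], [a, b, j, j, j, v, j, j, j, v, v, v, j, j, j, j, j, j, j, v, v, j, v, j, o, o, o],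
  [a, b, j, j, j, v, j, j, v, j, j, j, v, j, j, v, j, j, v, v, j, j, v, j, o, o, o], [a, b, j, j, j, v, j, j, v, v, v, j, j, j, j, j, j, v, v, j, j, j, j, v, o, o, o],
  [a, b, j, j, j, v, j, v, j, j, j, v, j, j, v, j, j, j, v, v, j, j, j, v, o, o, o]]

set_option maxHeartbeats 4000000 in
/-- Rows `141` – `187`. -/
def rowsD : List (List (Zsqrtd 105)) := [
  [a, b, j, j, j, v, j, v, j, v, j, j, j, v, j, v, j, j, v, j, v, j, j, j, o, o, o], [a, b, j, j, j, v, j, v, v, j, j, j, j, j, v, j, j, v, j, j, v, j, v, j, o, o, o],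
  [a, b, j, j, j, v, j, v, v, j, v, v, v, v, j, j, j, j, j, j, j, j, j, j, o, o, o], [a, b, j, j, j, v, j, v, v, v, j, j, j, j, j, j, v, j, j, v, j, v, j, j, o, o, o],
  [a, b, j, j, j, v, v, j, j, j, v, j, j, v, j, j, j, j, v, v, j, v, j, j, o, o, o], [a, b, j, j, j, v, v, j, j, v, j, v, v, j, j, j, v, j, v, j, j, j, j, j, o, o, o],
  [a, b, j, j, j, v, v, j, v, j, j, j, v, j, v, j, j, j, j, j, j, v, j, v, o, o, o], [a, b, j, j, j, v, v, j, v, j, v, j, j, j, j, v, v, j, j, j, v, j, j, j, o, o, o],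
  [a, b, j, j, j, v, v, v, j, j, j, j, j, v, j, j, v, v, j, j, j, j, j, v, o, o, o], [a, b, j, j, j, v, v, v, j, j, j, v, j, j, j, v, j, j, j, j, j, v, v, j, o, o, o],
  [a, b, j, j, v, j, j, j, j, j, j, j, j, v, v, j, j, j, v, v, v, j, v, j, o, o, o], [a, b, j, j, v, j, j, j, j, j, v, v, v, j, j, j, j, v, v, v, j, j, j, j, o, o, o],
  [a, b, j, j, v, j, j, j, j, v, j, j, j, v, j, j, v, v, v, j, j, v, j, j, o, o, o], [a, b, j, j, v, j, j, j, j, v, j, v, j, j, j, v, j, j, v, j, j, j, v, v, o, o, o],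
  [a, b, j, j, v, j, j, j, v, j, j, j, j, j, v, v, v, j, j, j, j, v, v, j, o, o, o], [a, b, j, j, v, j, j, j, v, j, j, v, j, v, v, j, j, v, j, j, j, j, j, v, o, o, o],
  [a, b, j, j, v, j, j, j, v, j, v, j, v, j, j, j, j, j, j, j, v, j, v, v, o, o, o], [a, b, j, j, v, j, j, j, v, v, j, j, j, j, j, v, j, v, j, v, v, j, j, j, o, o, o],
  [a, b, j, j, v, j, j, v, j, j, j, j, v, v, j, v, j, v, j, j, j, j, v, j, o, o, o], [a, b, j, j, v, j, j, v, j, j, j, v, v, j, j, j, v, j, j, j, j, v, j, v, o, o, o],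
  [a, b, j, j, v, j, j, v, j, j, v, v, j, j, v, v, j, j, j, j, v, j, j, j, o, o, o], [a, b, j, j, v, j, j, v, j, v, v, j, j, v, j, j, j, j, j, v, j, j, j, v, o, o, o],
  [a, b, j, j, v, j, j, v, v, v, j, j, v, j, v, j, j, j, v, j, j, j, j, j, o, o, o], [a, b, j, j, v, j, v, j, j, j, j, j, j, v, j, v, j, j, j, j, v, v, j, v, o, o, o],
  [a, b, j, j, v, j, v, j, j, j, j, v, j, j, j, j, v, v, j, j, v, j, v, j, o, o, o], [a, b, j, j, v, j, v, j, j, j, v, j, v, v, v, j, v, j, j, j, j, j, j, j, o, o, o],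
  [a, b, j, j, v, j, v, j, j, v, j, v, j, j, v, j, j, j, j, v, j, v, j, j, o, o, o], [a, b, j, j, v, j, v, j, v, j, j, j, j, j, j, j, v, j, v, v, j, j, j, v, o, o, o],
  [a, b, j, j, v, j, v, v, v, j, v, j, j, j, j, j, j, v, j, j, j, v, j, j, o, o, o], [a, b, j, j, v, v, j, j, j, j, j, j, j, j, j, j, j, v, j, v, j, v, v, v, o, o, o],
  [a, b, j, j, v, v, j, j, j, j, j, v, j, v, j, v, v, j, j, v, j, j, j, j, o, o, o], [a, b, j, j, v, v, j, j, j, v, j, j, j, j, v, j, v, j, j, j, v, j, j, v, o, o, o],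
  [a, b, j, j, v, v, j, j, j, v, v, j, v, j, j, v, j, j, j, j, j, v, j, j, o, o, o], [a, b, j, j, v, v, j, j, v, j, j, v, j, j, j, j, j, j, v, j, v, v, j, j, o, o, o],
  [a, b, j, j, v, v, j, v, j, j, v, j, j, j, j, j, v, j, v, j, j, j, v, j, o, o, o], [a, b, j, j, v, v, v, j, j, j, j, j, j, j, v, v, j, v, v, j, j, j, j, j, o, o, o],
  [a, b, j, j, v, v, v, j, v, v, j, j, j, v, j, j, j, j, j, j, j, j, v, j, o, o, o], [a, b, j, j, v, v, v, v, j, j, j, j, v, j, j, j, j, j, j, v, v, j, j, j, o, o, o],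
  [a, b, j, v, j, j, j, j, j, j, j, j, j, v, v, j, v, j, j, v, j, v, j, v, o, o, o], [a, b, j, v, j, j, j, j, j, j, j, v, j, j, v, v, j, v, j, v, j, j, v, j, o, o, o],
  [a, b, j, v, j, j, j, j, j, j, v, j, v, v, j, v, j, j, j, v, v, j, j, j, o, o, o], [a, b, j, v, j, j, j, j, j, v, j, j, j, v, j, j, j, v, j, j, v, j, v, v, o, o, o],
  [a, b, j, v, j, j, j, j, j, v, j, v, j, j, j, v, v, j, j, j, v, v, j, j, o, o, o], [a, b, j, v, j, j, j, j, j, v, v, v, v, j, v, j, j, j, j, j, j, j, j, v, o, o, o],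
  [a, b, j, v, j, j, j, j, v, j, j, j, j, j, v, v, j, j, v, j, v, j, j, v, o, o, o], [a, b, j, v, j, j, j, j, v, j, v, j, v, j, j, j, v, j, v, j, j, v, j, j, o, o, o],
  [a, b, j, v, j, j, j, j, v, v, j, v, j, v, j, j, j, j, v, v, j, j, j, j, o, o, o]]

set_option maxHeartbeats 4000000 in
/-- Rows `188` – `234`. -/
def rowsE : List (List (Zsqrtd 105)) := [
  [a, b, j, v, j, j, j, v, j, j, j, v, v, j, j, j, j, j, v, j, v, j, v, j, o, o, o], [a, b, j, v, j, j, j, v, j, j, v, j, j, v, v, j, j, v, v, j, j, j, j, j, o, o, o],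
  [a, b, j, v, j, j, j, v, v, j, j, j, v, j, j, j, j, v, j, v, j, j, j, v, o, o, o], [a, b, j, v, j, j, j, v, v, v, v, j, j, j, j, v, j, j, j, j, j, j, v, j, o, o, o],
  [a, b, j, v, j, j, v, j, j, j, j, j, j, v, j, v, v, j, v, j, j, j, v, j, o, o, o], [a, b, j, v, j, j, v, j, j, j, j, v, j, j, j, j, j, v, v, j, j, v, j, v, o, o, o],
  [a, b, j, v, j, j, v, j, v, j, j, j, j, j, j, j, j, j, j, v, v, v, v, j, o, o, o], [a, b, j, v, j, j, v, j, v, v, j, j, j, j, v, j, v, v, j, j, j, j, j, j, o, o, o],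
  [a, b, j, v, j, j, v, v, j, j, v, v, j, j, j, j, v, j, j, v, j, j, j, j, o, o, o], [a, b, j, v, j, j, v, v, j, v, j, j, v, v, j, j, j, j, j, j, j, v, j, j, o, o, o],
  [a, b, j, v, j, v, j, j, j, j, j, j, j, j, j, j, v, v, v, v, v, j, j, j, o, o, o], [a, b, j, v, j, v, j, j, j, v, j, j, j, j, v, j, j, j, v, j, j, v, v, j, o, o, o],
  [a, b, j, v, j, v, j, j, v, j, j, j, j, v, j, v, j, v, j, j, j, v, j, j, o, o, o], [a, b, j, v, j, v, j, j, v, j, j, v, j, j, j, j, v, j, j, j, j, j, v, v, o, o, o],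
  [a, b, j, v, j, v, j, v, j, j, j, j, v, j, v, v, v, j, j, j, j, j, j, j, o, o, o], [a, b, j, v, j, v, j, v, j, j, v, j, j, j, j, j, j, j, j, j, v, v, j, v, o, o, o],
  [a, b, j, v, j, v, v, j, j, j, j, v, j, v, v, j, j, j, j, j, v, j, j, j, o, o, o], [a, b, j, v, j, v, v, j, j, j, v, j, v, j, j, j, j, v, j, j, j, j, v, j, o, o, o],
  [a, b, j, v, j, v, v, j, j, v, j, j, j, j, j, v, j, j, j, v, j, j, j, v, o, o, o], [a, b, j, v, v, j, j, j, j, j, j, j, v, j, v, j, j, v, j, j, v, v, j, j, o, o, o],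
  [a, b, j, v, v, j, j, j, j, j, v, j, j, j, j, v, v, v, j, j, j, j, j, v, o, o, o], [a, b, j, v, v, j, j, j, j, j, v, v, j, v, j, j, j, j, j, j, j, v, v, j, o, o, o],
  [a, b, j, v, v, j, j, j, j, v, j, j, v, j, j, j, v, j, j, v, j, j, v, j, o, o, o], [a, b, j, v, v, j, j, v, j, j, j, j, j, j, j, v, j, j, v, v, j, v, j, j, o, o, o],
  [a, b, j, v, v, j, j, v, v, j, j, j, j, v, j, j, v, j, j, j, v, j, j, j, o, o, o], [a, b, j, v, v, j, v, j, j, v, v, j, j, j, j, j, j, j, v, j, v, j, j, j, o, o, o],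
  [a, b, j, v, v, j, v, j, v, j, j, v, v, j, j, v, j, j, j, j, j, j, j, j, o, o, o], [a, b, j, v, v, j, v, v, j, j, j, j, j, j, v, j, j, j, j, j, j, j, v, v, o, o, o],
  [a, b, j, v, v, v, j, j, j, j, j, j, v, v, j, j, j, j, v, j, j, j, j, v, o, o, o], [a, b, j, v, v, v, j, j, v, j, v, j, j, j, v, j, j, j, j, v, j, j, j, j, o, o, o],
  [a, b, j, v, v, v, j, v, j, v, j, v, j, j, j, j, j, v, j, j, j, j, j, j, o, o, o], [a, b, v, j, j, j, j, j, j, j, j, j, j, v, v, v, v, v, j, j, v, j, j, j, o, o, o],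
  [a, b, v, j, j, j, j, j, j, j, j, v, j, j, v, j, j, j, j, j, v, v, v, v, o, o, o], [a, b, v, j, j, j, j, j, j, j, v, j, v, v, j, j, j, v, j, j, j, v, j, v, o, o, o],
  [a, b, v, j, j, j, j, j, j, j, v, v, v, j, j, v, v, j, j, j, j, j, v, j, o, o, o], [a, b, v, j, j, j, j, j, j, v, j, j, j, v, j, v, j, j, j, v, j, v, v, j, o, o, o],
  [a, b, v, j, j, j, j, j, j, v, j, v, j, j, j, j, v, v, j, v, j, j, j, v, o, o, o], [a, b, v, j, j, j, j, j, v, j, j, j, j, j, v, j, j, v, v, v, j, v, j, j, o, o, o],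
  [a, b, v, j, j, j, j, j, v, v, j, j, j, j, j, j, v, j, v, j, v, j, v, j, o, o, o], [a, b, v, j, j, j, j, v, j, j, j, j, v, v, j, j, v, j, v, v, j, j, j, j, o, o, o],
  [a, b, v, j, j, j, j, v, j, v, v, v, j, j, j, j, j, j, v, j, j, v, j, j, o, o, o], [a, b, v, j, j, j, j, v, v, j, j, j, v, j, j, v, j, j, j, j, v, v, j, j, o, o, o],
  [a, b, v, j, j, j, j, v, v, j, v, j, j, j, v, j, v, j, j, j, j, j, j, v, o, o, o], [a, b, v, j, j, j, v, j, j, j, j, v, j, j, j, v, j, j, v, v, v, j, j, j, o, o, o],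
  [a, b, v, j, j, j, v, j, j, v, j, j, j, v, v, j, j, j, v, j, j, j, j, v, o, o, o], [a, b, v, j, j, j, v, j, v, j, j, j, j, j, j, v, j, v, j, j, j, j, v, v, o, o, o],
  [a, b, v, j, j, j, v, j, v, j, j, v, j, v, j, j, v, j, j, j, j, v, j, j, o, o, o]]

set_option maxHeartbeats 4000000 in
/-- Rows `235` – `280`. -/
def rowsF : List (List (Zsqrtd 105)) := [
  [a, b, v, j, j, j, v, j, v, v, v, j, v, j, j, j, j, j, j, v, j, j, j, j, o, o, o], [a, b, v, j, j, j, v, v, j, j, j, v, v, j, v, j, j, v, j, j, j, j, j, j, o, o, o],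
  [a, b, v, j, j, j, v, v, j, j, v, j, j, v, j, j, j, j, j, j, v, j, v, j, o, o, o], [a, b, v, j, j, v, j, j, j, j, j, j, j, j, j, v, v, j, v, j, j, v, j, v, o, o, o],
  [a, b, v, j, j, v, j, j, j, j, j, v, j, v, j, j, j, v, v, j, j, j, v, j, o, o, o], [a, b, v, j, j, v, j, j, j, j, v, j, v, j, v, j, j, j, v, j, v, j, j, j, o, o, o],
  [a, b, v, j, j, v, j, j, v, j, j, j, j, v, j, j, j, j, j, v, v, j, j, v, o, o, o], [a, b, v, j, j, v, j, j, v, v, j, v, j, j, v, v, j, j, j, j, j, j, j, j, o, o, o],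
  [a, b, v, j, j, v, j, v, j, j, v, j, j, j, j, v, j, v, j, v, j, j, j, j, o, o, o], [a, b, v, j, j, v, j, v, j, v, j, j, v, j, j, j, j, j, j, j, j, j, v, v, o, o, o],
  [a, b, v, j, j, v, v, j, j, j, j, j, j, j, v, j, v, j, j, v, j, j, v, j, o, o, o], [a, b, v, j, j, v, v, j, j, v, j, j, j, j, j, j, j, v, j, j, v, v, j, j, o, o, o],
  [a, b, v, j, v, j, j, j, j, j, j, j, v, j, v, v, j, j, j, v, j, j, j, v, o, o, o], [a, b, v, j, v, j, j, j, j, j, v, j, j, j, j, j, v, j, j, v, v, v, j, j, o, o, o],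
  [a, b, v, j, v, j, j, j, j, v, j, v, v, v, j, j, j, j, j, j, v, j, j, j, o, o, o], [a, b, v, j, v, j, j, j, j, v, v, j, j, j, v, j, j, v, j, j, j, j, v, j, o, o, o],
  [a, b, v, j, v, j, j, j, v, j, v, j, j, v, j, v, j, j, v, j, j, j, j, j, o, o, o], [a, b, v, j, v, j, j, v, j, j, j, j, j, j, j, j, j, v, v, j, v, j, j, v, o, o, o],
  [a, b, v, j, v, j, j, v, v, j, j, v, j, j, j, j, j, j, j, v, j, j, v, j, o, o, o], [a, b, v, j, v, j, v, j, j, j, j, j, v, j, j, j, j, j, v, j, j, v, v, j, o, o, o],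
  [a, b, v, j, v, j, v, v, j, v, j, j, j, j, j, v, v, j, j, j, j, j, j, j, o, o, o], [a, b, v, j, v, v, j, j, v, j, j, j, v, j, j, j, v, v, j, j, j, j, j, j, o, o, o],
  [a, b, v, j, v, v, j, v, j, j, j, j, j, v, v, j, j, j, j, j, j, v, j, j, o, o, o], [a, b, v, j, v, v, v, j, j, j, v, v, j, j, j, j, j, j, j, j, j, j, j, v, o, o, o],
  [a, b, v, v, j, j, j, j, j, j, v, j, j, j, j, j, j, j, v, v, j, j, v, v, o, o, o], [a, b, v, v, j, j, j, j, j, v, j, j, v, j, j, v, j, v, v, j, j, j, j, j, o, o, o],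
  [a, b, v, v, j, j, j, j, v, j, j, j, v, v, v, j, j, j, j, j, j, j, v, j, o, o, o], [a, b, v, v, j, j, j, j, v, j, v, v, j, j, j, j, j, v, j, j, v, j, j, j, o, o, o],
  [a, b, v, v, j, j, j, v, j, j, j, j, j, j, j, j, v, v, j, j, j, v, v, j, o, o, o], [a, b, v, v, j, j, j, v, j, j, j, v, j, v, j, v, j, j, j, j, j, j, j, v, o, o, o],
  [a, b, v, v, j, j, j, v, j, v, j, j, j, j, v, j, j, j, j, v, v, j, j, j, o, o, o], [a, b, v, v, j, j, v, j, j, j, j, j, v, j, j, j, v, j, j, j, v, j, j, v, o, o, o],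
  [a, b, v, v, j, j, v, j, j, j, v, j, j, j, v, v, j, j, j, j, j, v, j, j, o, o, o], [a, b, v, v, j, v, j, j, j, j, j, v, v, j, j, j, j, j, j, v, j, v, j, j, o, o, o],
  [a, b, v, v, j, v, j, j, j, v, v, j, j, v, j, j, v, j, j, j, j, j, j, j, o, o, o], [a, b, v, v, j, v, v, v, v, j, j, j, j, j, j, j, j, j, v, j, j, j, j, j, o, o, o],
  [a, b, v, v, v, j, j, j, j, j, j, v, j, j, v, j, v, j, v, j, j, j, j, j, o, o, o], [a, b, v, v, v, j, j, j, v, v, j, j, j, j, j, j, j, j, j, j, j, v, j, v, o, o, o],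
  [a, b, v, v, v, j, v, j, j, j, j, j, j, v, j, j, j, v, j, v, j, j, j, j, o, o, o], [a, b, v, v, v, v, j, j, j, j, j, j, j, j, j, v, j, j, j, j, v, j, v, j, o, o, o],
  [c, d, h, d, d, d, d, h, h, d, h, d, s, d, d, d, d, h, h, d, d, d, h, d, y, z, o], [d, c, i, c, c, c, c, i, i, c, i, c, r, c, c, c, c, i, i, c, c, c, i, c, y, o, z],
  [c, d, h, d, d, d, d, h, h, d, h, d, s, d, d, d, d, h, h, d, d, d, h, d, o, y, z], [d, c, i, c, c, c, c, i, i, c, i, c, r, c, c, c, c, i, i, c, c, c, i, c, z, y, o],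
  [c, d, h, d, d, d, d, h, h, d, h, d, s, d, d, d, d, h, h, d, d, d, h, d, z, o, y], [d, c, i, c, c, c, c, i, i, c, i, c, r, c, c, c, c, i, i, c, c, c, i, c, o, z, y]]

/-- All `281` rows. -/
def rows : List (List (Zsqrtd 105)) := rowsA ++ rowsB ++ rowsC ++ rowsD ++ rowsE ++ rowsF

/-- Products of two distinct rows (squared length `4320`), with pair counts: `720` (×22581), `0` (×1050), `-720` (×306), `-1080` (×15400), `-4320` (×3) — all `≤ 4320·1/6`. -/
def keys : List (Zsqrtd 105) := [⟨720, 0⟩, ⟨0, 0⟩, ⟨-720, 0⟩, ⟨-1080, 0⟩, ⟨-4320, 0⟩]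

/-- Kernel check: `281` rows. -/
theorem length_rows : rows.length = 281 := by decide +kernel

set_option maxRecDepth 100000 in
/-- Kernel check: every row has length `27` and squared length `4320`. -/
theorem shape_rows : shapeOK rows 27 (⟨4320, 0⟩ : Zsqrtd 105) = true := by decide +kernel

set_option maxRecDepth 100000 in
set_option maxHeartbeats 4000000 in
/-- Kernel check (chunk `rowsA`): products of its rows with all other rows are keys. -/
theorem keys_rowsA : keysRowsOK rows keys rowsA = true := by decide +kernel

set_option maxRecDepth 100000 in
set_option maxHeartbeats 4000000 in
/-- Kernel check (chunk `rowsB`): products of its rows with all other rows are keys. -/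
theorem keys_rowsB : keysRowsOK rows keys rowsB = true := by decide +kernel

set_option maxRecDepth 100000 in
set_option maxHeartbeats 4000000 in
/-- Kernel check (chunk `rowsC`): products of its rows with all other rows are keys. -/
theorem keys_rowsC : keysRowsOK rows keys rowsC = true := by decide +kernel

set_option maxRecDepth 100000 in
set_option maxHeartbeats 4000000 in
/-- Kernel check (chunk `rowsD`): products of its rows with all other rows are keys. -/
theorem keys_rowsD : keysRowsOK rows keys rowsD = true := by decide +kernel

set_option maxRecDepth 100000 in
set_option maxHeartbeats 4000000 in
/-- Kernel check (chunk `rowsE`): products of its rows with all other rows are keys. -/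
theorem keys_rowsE : keysRowsOK rows keys rowsE = true := by decide +kernel

set_option maxRecDepth 100000 in
set_option maxHeartbeats 4000000 in
/-- Kernel check (chunk `rowsF`): products of its rows with all other rows are keys. -/
theorem keys_rowsF : keysRowsOK rows keys rowsF = true := by decide +kernel

/-- Kernel check: every product of two distinct rows is one of the `keys`. -/
theorem keys_rows : keysRowsOK rows keys rows = true := by
  show keysRowsOK rows keys (rowsA ++ rowsB ++ rowsC ++ rowsD ++ rowsE ++ rowsF) = true
  simp only [keysRowsOK_append, keys_rowsA, keys_rowsB, keys_rowsC, keys_rowsD, keys_rowsE, keys_rowsF, Bool.and_self]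

/-- The `3` normals (pairwise orthogonal, nonzero); every row is orthogonal to them, so the code lies in a subspace of dimension `24`. -/
def normals : List (List (Zsqrtd 105)) := [
  [e, p, p, p, p, p, p, p, p, p, p, p, p, p, p, p, p, p, p, p, p, p, p, p, o, o, o],
  [a, g, m, m, m, m, m, m, m, m, m, m, m, m, m, m, m, m, m, m, m, m, m, m, o, o, o],
  [o, o, o, o, o, o, o, o, o, o, o, o, o, o, o, o, o, o, o, o, o, o, o, o, p, p, p]]

set_option maxRecDepth 100000 in
/-- Kernel check: the normals have length `27`, are nonzero and pairwise orthogonal. -/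
theorem normals_ok : normalsOK normals 27 = true := by decide +kernel

set_option maxRecDepth 100000 in
set_option maxHeartbeats 4000000 in
/-- Kernel check: every row is orthogonal to every normal. -/
theorem orth_rows : orthOK normals rows = true := by decide +kernel

/-- `4320` is not a key. -/
private theorem q_not_key : (⟨4320, 0⟩ : Zsqrtd 105) ∉ keys := by decide

/-- `ι 4320 > 0`. -/
private theorem hq : 0 < (Zsqrtd.toReal hD) (⟨4320, 0⟩ : Zsqrtd 105) := by
  rw [Zsqrtd.toReal_apply]; push_cast; norm_num

/-- Every key, normalised by `4320`, is `≤ 1/6` (all keys are rational integers `≤ 720`). -/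
private theorem keys_le : ∀ k ∈ keys,
    (Zsqrtd.toReal hD) k / (Zsqrtd.toReal hD) (⟨4320, 0⟩ : Zsqrtd 105) ≤ 1 / 6 := by
  intro k hk
  simp only [keys, List.mem_cons, List.not_mem_nil, or_false] at hk
  rw [div_le_div_iff₀ hq (by norm_num)]
  rcases hk with rfl | rfl | rfl | rfl | rfl <;>
    (rw [Zsqrtd.toReal_apply, Zsqrtd.toReal_apply]; push_cast; norm_num)

/-- **`A(24, arccos 1/6) ≥ 281`**: the `275` McLaughlin vectors `(v, 0)` and six points `((−1)^j (√2/3) u, (√7/3) h_j)`, `u = w/√60` the flat direction, `h_j` a regular hexagon (realised in the plane `x+y+z = 0` of `ℝ³`); ambient `ℝ²⁷` with three normals, transferred to `ℝ²⁴`. -/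
theorem exists_code_dim24_sixth_281 : ∃ C : Finset (EuclideanSpace ℝ (Fin 24)), C.card = 281 ∧
    (∀ x ∈ C, ‖x‖ = 1) ∧ ∀ x ∈ C, ∀ y ∈ C, x ≠ y → inner ℝ x y ≤ 1 / 6 := by
  have hι := Zsqrtd.toReal_injective hD d_not_square
  obtain ⟨C', hcard, hnorm, hinner, -⟩ := exists_transfer_orthogonal (m := 27) (n := 24) (k := normals.length) rfl
    (fun i : Fin normals.length => vec (Zsqrtd.toReal hD) 27 (⟨4320, 0⟩ : Zsqrtd 105) normals[(i : ℕ)])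
    (linearIndependent_normals hι hq normals normals_ok)
    (config (Zsqrtd.toReal hD) 27 (⟨4320, 0⟩ : Zsqrtd 105) rows) (inner_normals_eq_zero hq shape_rows normals normals_ok orth_rows)
  refine ⟨C', ?_, ?_, ?_⟩
  · rw [hcard, card_eq_keys hι hq shape_rows keys_rows q_not_key, length_rows]
  · intro x' hx'
    obtain ⟨x, hx, he⟩ := hnorm x' hx'
    rw [he]
    exact norm_eq_one hq shape_rows x hx
  · intro x' hx' y' hy' hne
    obtain ⟨x, hx, y, hy, hxy, he⟩ := hinner x' hx' y' hy' hne
    rw [he]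
    exact inner_le_keys hq shape_rows keys_rows (1 / 6) keys_le x hx y hy hxy

end Summit.Ventures.PackingBounds.Config.CodeSixth24McLHexagon
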